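/-
# The Wolff-packing model: exact lattice cancellation inside the zero-side class — part B (§3)

(rh-split cell, seat rh-split-screw-bridge g13, 2026-08-27; kernel scratch for card `cards/SPLIT-screw-bridge.md` §18,
barrier candidate B16.)  Part B of the three-part carve of `HOME/rh-split-screw-bridge/g13/ScrewLatticeWolff.lean`
(sha16 14a22eecb442a4a4, 637 l): §3 = source ll. 223–388 byte-identical, namespace re-opened (FQNs unchanged).
Nothing in this file is a claim about the truth of RH; no declaration mentions `ζ`.
-/
import Summits.RiemannHypothesis.RiemannHypothesis.Theorems.Splittings.ScrewLatticeWolffA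
import HarnessLib

/-!
# Part B — negative definite sequences `k ↦ 1 - Re u^{|k|}`: finite Gram identities (§3)

CARVE NOTE (author rh-split-screw-bridge g13, lead RULING #161 (3)–(4), 2026-08-27): source ll. 223–388 of the frozen
`ScrewLatticeWolff.lean` 14a22eecb442a4a4 reproduced BYTE-IDENTICALLY between the `namespace` line below and the closing
`end`; preamble (`set_option`, `noncomputable section`, `open`s) copied from source ll. 65–70.  Contents: `sum_sum_re_mul_conj_nonneg`, `ndist…`, `gramVec`, `gramKernel…`, `gramKernel_form_nonneg`, `negdefForm_nonneg`.
-/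

set_option linter.dupNamespace false

noncomputable section

open Complex Filter Topology Finset
open scoped ComplexConjugate

namespace Summit.RiemannHypothesis.RiemannHypothesis.Theorems.Splittings.ScrewLatticeWolff

/-! ## 3. Negative definite sequences `k ↦ 1 - Re u^{|k|}` (`|u| ≤ 1`): finite Gram identities -/

/-- `Σ_{a,b} Re(z_a conj z_b) x_a x_b = |Σ_a z_a x_a|² ≥ 0` (real coefficients). -/
theorem sum_sum_re_mul_conj_nonneg {N : ℕ} (z : Fin N → ℂ) (x : Fin N → ℝ) :
    0 ≤ ∑ a, ∑ b, (z a * conj (z b)).re * (x a * x b) := by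
  have key : ∑ a, ∑ b, (z a * conj (z b)).re * (x a * x b) =
      ((∑ a, z a * x a) * conj (∑ b, z b * x b)).re := by
    rw [map_sum, Finset.sum_mul_sum, Complex.re_sum]
    refine Finset.sum_congr rfl fun a _ ↦ ?_
    rw [Complex.re_sum]
    refine Finset.sum_congr rfl fun b _ ↦ ?_
    rw [map_mul, Complex.conj_ofReal]
    have : z a * (x a : ℂ) * (conj (z b) * (x b : ℂ)) = ((x a * x b : ℝ) : ℂ) * (z a * conj (z b)) := by
      push_cast; ring
    rw [this, Complex.re_ofReal_mul]; ring
  rw [key, Complex.mul_conj, Complex.ofReal_re]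
  exact Complex.normSq_nonneg _

/-- Lattice distance `|p - q|` on `ℕ`. -/
def ndist (p q : ℕ) : ℕ := if q ≤ p then p - q else q - p

/-- `ndist` is symmetric. [folklore] -/
theorem ndist_comm (p q : ℕ) : ndist p q = ndist q p := by
  unfold ndist; split_ifs <;> omega

/-- `ndist 0 q = q`. [folklore] -/
theorem ndist_zero_left (q : ℕ) : ndist 0 q = q := by
  unfold ndist; split_ifs <;> omega

/-- `ndist p 0 = p`. [folklore] -/
theorem ndist_zero_right (p : ℕ) : ndist p 0 = p := by
  unfold ndist; split_ifs <;> omega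

/-- `ndist p p = 0`. [folklore] -/
theorem ndist_self (p : ℕ) : ndist p p = 0 := by
  unfold ndist; split_ifs <;> omega

/-- Gram vectors `v_n(p) = u^{n-p}` (`p ≤ n`), `0` otherwise. -/
def gramVec (u : ℂ) (n p : ℕ) : ℂ := if p ≤ n then u ^ (n - p) else 0

/-- The truncated Gram kernel `G_L(p,q) = (1 - |u|²) Σ_{n<L} v_n(p) conj v_n(q) + v_L(p) conj v_L(q)`. -/
def gramKernel (u : ℂ) (L p q : ℕ) : ℂ :=
  ((1 - ‖u‖ ^ 2 : ℝ) : ℂ) * ∑ n ∈ Finset.range L, gramVec u n p * conj (gramVec u n q) +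
    gramVec u L p * conj (gramVec u L q)

/-- The Gram kernel does not depend on the truncation `L ≥ max(p,q)`: one induction step. -/
theorem gramKernel_succ (u : ℂ) {L p q : ℕ} (hp : p ≤ L) (hq : q ≤ L) :
    gramKernel u (L + 1) p q = gramKernel u L p q := by
  unfold gramKernel
  rw [Finset.sum_range_succ]
  have hvL : ∀ {r : ℕ}, r ≤ L → gramVec u (L + 1) r = gramVec u L r * u := fun {r} hr ↦ by
    unfold gramVec
    rw [if_pos hr, if_pos (hr.trans (Nat.le_succ L)), Nat.succ_sub hr, pow_succ]
  rw [hvL hp, hvL hq, map_mul]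
  have huu : u * conj u = ((‖u‖ ^ 2 : ℝ) : ℂ) := by
    rw [Complex.mul_conj, Complex.normSq_eq_norm_sq]
  set X : ℂ := gramVec u L p * conj (gramVec u L q) with hX
  have e : gramVec u L p * u * (conj (gramVec u L q) * conj u) = X * (u * conj u) := by rw [hX]; ring
  rw [e, huu, mul_add]
  push_cast
  ring

/-- **GRAM IDENTITY**: for `p, q ≤ L`, `Re G_L(p,q) = Re u^{|p-q|}`. -/
theorem gramKernel_re_eq (u : ℂ) :
    ∀ L p q : ℕ, p ≤ L → q ≤ L → (gramKernel u L p q).re = (u ^ ndist p q).re := by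
  intro L
  induction L with
  | zero =>
    intro p q hp hq
    obtain rfl : p = 0 := Nat.le_zero.1 hp
    obtain rfl : q = 0 := Nat.le_zero.1 hq
    simp [gramKernel, gramVec, ndist]
  | succ L ih =>
    intro p q hp hq
    rcases Nat.le_succ_iff.1 hp with hp' | rfl
    · rcases Nat.le_succ_iff.1 hq with hq' | rfl
      · rw [gramKernel_succ u hp' hq']
        exact ih p q hp' hq'
      · -- `q = L + 1 > p`: the sum is empty at index `q`
        have hv : ∀ n ∈ Finset.range (L + 1), gramVec u n p * conj (gramVec u n (L + 1)) = 0 := by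
          intro n hn
          have hn' : ¬ (L + 1 ≤ n) := by rw [Finset.mem_range] at hn; omega
          simp [gramVec, hn']
        unfold gramKernel
        rw [Finset.sum_eq_zero hv, mul_zero, zero_add]
        simp only [gramVec, if_pos hp, le_refl, if_true, Nat.sub_self, pow_zero, map_one, mul_one]
        unfold ndist
        rw [if_neg (by omega)]
    · rcases Nat.le_succ_iff.1 hq with hq' | rfl
      · have hv : ∀ n ∈ Finset.range (L + 1), gramVec u n (L + 1) * conj (gramVec u n q) = 0 := by
          intro n hn
          have hn' : ¬ (L + 1 ≤ n) := by rw [Finset.mem_range] at hn; omega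
          simp [gramVec, hn']
        unfold gramKernel
        rw [Finset.sum_eq_zero hv, mul_zero, zero_add]
        simp only [gramVec, if_pos hq, le_refl, if_true, Nat.sub_self, pow_zero, one_mul]
        unfold ndist
        rw [if_pos (by omega)]
        exact Complex.conj_re _
      · have hv : ∀ n ∈ Finset.range (L + 1),
            gramVec u n (L + 1) * conj (gramVec u n (L + 1)) = 0 := by
          intro n hn
          have hn' : ¬ (L + 1 ≤ n) := by rw [Finset.mem_range] at hn; omega
          simp [gramVec, hn']
        unfold gramKernel
        rw [Finset.sum_eq_zero hv, mul_zero, zero_add]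
        simp only [gramVec, le_refl, if_true, Nat.sub_self, pow_zero, map_one, mul_one, ndist_self,
          Complex.one_re]

/-- The Gram form is non-negative for `|u| ≤ 1`. -/
theorem gramKernel_form_nonneg {u : ℂ} (hu : ‖u‖ ≤ 1) (L : ℕ) {N : ℕ} (p : Fin N → ℕ)
    (x : Fin N → ℝ) : 0 ≤ ∑ a, ∑ b, (gramKernel u L (p a) (p b)).re * (x a * x b) := by
  have expand : ∀ a b, (gramKernel u L (p a) (p b)).re * (x a * x b) =
      (1 - ‖u‖ ^ 2) * ∑ n ∈ Finset.range L,
          (gramVec u n (p a) * conj (gramVec u n (p b))).re * (x a * x b) +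
        (gramVec u L (p a) * conj (gramVec u L (p b))).re * (x a * x b) := by
    intro a b
    rw [gramKernel, Complex.add_re, Complex.re_ofReal_mul, Complex.re_sum, add_mul, mul_assoc,
      Finset.sum_mul]
  simp_rw [expand]
  simp only [Finset.sum_add_distrib, ← Finset.mul_sum]
  have hswap : ∑ a, ∑ b, ∑ n ∈ Finset.range L,
      (gramVec u n (p a) * conj (gramVec u n (p b))).re * (x a * x b) =
      ∑ n ∈ Finset.range L, ∑ a, ∑ b,
        (gramVec u n (p a) * conj (gramVec u n (p b))).re * (x a * x b) := by
    calc ∑ a, ∑ b, ∑ n ∈ Finset.range L, (gramVec u n (p a) * conj (gramVec u n (p b))).re * (x a * x b)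
        = ∑ a, ∑ n ∈ Finset.range L, ∑ b,
            (gramVec u n (p a) * conj (gramVec u n (p b))).re * (x a * x b) :=
          Finset.sum_congr rfl fun a _ ↦ Finset.sum_comm
      _ = ∑ n ∈ Finset.range L, ∑ a, ∑ b,
            (gramVec u n (p a) * conj (gramVec u n (p b))).re * (x a * x b) := Finset.sum_comm
  rw [hswap]
  refine add_nonneg ?_ (sum_sum_re_mul_conj_nonneg (fun a ↦ gramVec u L (p a)) x)
  refine mul_nonneg (by nlinarith [norm_nonneg u]) ?_
  exact Finset.sum_nonneg fun n _ ↦ sum_sum_re_mul_conj_nonneg (fun a ↦ gramVec u n (p a)) x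

/-- **NEGATIVE DEFINITENESS of `k ↦ 1 - Re u^{|k|}` (`|u| ≤ 1`)**: the kernel
`g(p) + g(q) - g(|p - q|)`, `g(k) = 1 - Re u^k`, is non-negative definite on `ℕ`
(augment the configuration by the point `0` with weight `-Σ x` and use the Gram form). -/
theorem negdefForm_nonneg {u : ℂ} (hu : ‖u‖ ≤ 1) {N : ℕ} (p : Fin N → ℕ) (x : Fin N → ℝ) :
    0 ≤ ∑ a, ∑ b, ((1 - (u ^ p a).re) + (1 - (u ^ p b).re) - (1 - (u ^ ndist (p a) (p b)).re)) *
      (x a * x b) := by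
  have hpL : ∀ a, p a ≤ ∑ c, p c := fun a ↦
    Finset.single_le_sum (f := p) (fun c _ ↦ Nat.zero_le _) (Finset.mem_univ a)
  set L := ∑ c, p c with hL
  have hP : ∀ a' : Fin (N + 1), (Fin.cons 0 p : Fin (N + 1) → ℕ) a' ≤ L := fun a' ↦ by
    refine Fin.cases ?_ (fun a ↦ ?_) a'
    · simp
    · simpa using hpL a
  have hG := gramKernel_form_nonneg hu L (Fin.cons 0 p : Fin (N + 1) → ℕ)
    (Fin.cons (-∑ c, x c) x : Fin (N + 1) → ℝ)
  have hG' : 0 ≤ ∑ a' : Fin (N + 1), ∑ b' : Fin (N + 1),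
      (u ^ ndist ((Fin.cons 0 p : Fin (N + 1) → ℕ) a') ((Fin.cons 0 p : Fin (N + 1) → ℕ) b')).re *
        ((Fin.cons (-∑ c, x c) x : Fin (N + 1) → ℝ) a' *
          (Fin.cons (-∑ c, x c) x : Fin (N + 1) → ℝ) b') := by
    refine hG.trans_eq (Finset.sum_congr rfl fun a' _ ↦ Finset.sum_congr rfl fun b' _ ↦ ?_)
    rw [gramKernel_re_eq u L _ _ (hP a') (hP b')]
  simp only [Fin.sum_univ_succ, Fin.cons_zero, Fin.cons_succ, ndist_zero_left, ndist_zero_right,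
    pow_zero, Complex.one_re, one_mul] at hG'
  have h2 : ∀ b, (u ^ p b).re * (-(∑ c, x c) * x b) = -(∑ c, x c) * ((u ^ p b).re * x b) :=
    fun b ↦ by ring
  have h3 : ∀ a, (u ^ p a).re * (x a * -(∑ c, x c)) = -(∑ c, x c) * ((u ^ p a).re * x a) :=
    fun a ↦ by ring
  simp only [h2, h3, Finset.sum_add_distrib, ← Finset.mul_sum] at hG'
  have h1 : ∀ a b, ((1 - (u ^ p a).re) + (1 - (u ^ p b).re) - (1 - (u ^ ndist (p a) (p b)).re)) *
      (x a * x b) = x a * x b - ((u ^ p a).re * x a) * x b - x a * ((u ^ p b).re * x b) +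
        (u ^ ndist (p a) (p b)).re * (x a * x b) := fun a b ↦ by ring
  simp only [h1, Finset.sum_add_distrib, Finset.sum_sub_distrib, ← Finset.sum_mul_sum]
  linarith [hG']


end Summit.RiemannHypothesis.RiemannHypothesis.Theorems.Splittings.ScrewLatticeWolff

end
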